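import Literature.Probability.Percolation.TriRSWChaining
import HarnessLib

/-!
# Lowest crossings of a lattice domain of `𝕋`: an abstract exploration toolkit

Topic: Probability / Percolation; family `crit-perc` (site percolation on the triangular lattice
`𝕋 = triGraph`). First brick of the discharge of `Literature.Probability.Percolation.Nolin2008_twoArm_separation`
(Nolin 2008, Thm. 11 [arXiv 0711.4948: Thm. 10], arm separation; `ArmSeparation.lean`), whose
proof (Nolin 2008, §4.4, Lemma 15 [arXiv Lemma 14], after Kesten 1987) explores, in a U-shaped
region of the last annulus, "the lowest (ie closest to the bottom side) monochromatic crossing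
`c₁`, then `c₂` the lowest monochromatic crossing disjoint from `c₁`, and so on", using that
"the event `{c_v = c̃_v, v ≤ u}` is independent from the status of the sites above `c̃_u`".
This file provides that combinatorial machine — the **lowest crossing** of Kesten
(*Percolation theory for mathematicians* (1982), §2.3, Prop. 2.3: "the lowest occupied
crosscut", whose defining event "depends only on the occupancies of vertices on or below it")
— for an arbitrary finite domain of `𝕋`, abstractly, from two planar-topological hypotheses on
the domain which are established for the concrete regions elsewhere (by reduction to the Hex
lemma `tri_hex` and to `PathIn.tri_crossings_meet`).

## Setting (`JDomain`)

A `JDomain` is a finite set of sites `D` with four distinguished subsets: the **tip arc** `J`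
(where crossings end; linearly ordered by a height function `ht`, injective on `J`), the
**start set** `F` (where crossings start), and two reference arcs `Bt` ("below `J`") and `Tp`
("above `J`"). A **crossing** (`IsCrossing c z`) is a `𝕋`-connected set of sites `c ⊆ D`
meeting `F`, and meeting `J` in exactly one site, its **tip** `z`. For a crossing, `above c z`
is the set of sites of `D ∖ c` joined inside `D ∖ c` to the reference set
`ref c z = (J_{>z} ∪ Tp) ∖ c` ("the region above the crossing"), `below c z` the rest of
`D ∖ c`, and `lower c z = c ∪ below c z` ("on or below"). The two hypotheses are

* `CutProp` (every crossing cuts the domain): no `𝕋`-path of `D ∖ c` joins `Bt ∪ J_{<z}` to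
  `Tp ∪ J_{>z}` — in print, planarity / the Jordan curve theorem;
* `DualProp` (duality): for every `S ⊆ D`, either `S` contains a path from `F` to `J`, or
  `D ∖ S` contains a path from `Bt` to `Tp` — in print, the self-matching property of `𝕋`
  (Bollobás–Riordan 2006, Ch. 7, Lemma 5; Kesten 1982, §2.2).

## Results

* `above`/`below` calculus: `ref ⊆ above`, closure of `above` under `𝕋`-steps in `D ∖ c`, no
  edge between `above` and `below` (`not_adj_above_below`).
* `exists_crossing_subset` — a path of `S` from `F` to `J` contains a crossing inside `S`.
* `IsCrossing.subset_above_or_disjoint`, `IsCrossing.compare` — **comparability**: of two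
  disjoint crossings, the one with the higher tip lies above the other, which lies below it
  (from `CutProp`).
* `IsCrossing.above_ssubset_above_of_subset_below` — a crossing strictly below another has a
  strictly larger region above it (the potential `#(D ∖ above)` strictly decreases downwards).
* `exists_crossing_envelope` — **the lower envelope** (from `DualProp` and `CutProp`): for two
  crossings `K, K'`, the set `(K ∖ above K') ∪ (K' ∖ above K)` contains a crossing `E`, and
  `above E ⊇ above K ∪ above K'`.
* `lowest ω` — **the lowest open crossing** of a configuration `ω` (the open crossing minimising
  `#(D ∖ above)`, ties broken by a fixed enumeration): it exists as soon as an open crossing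
  exists (`lowest_ne_none`), no open crossing lies strictly below it (`not_subset_below_lowest`),
  and — Kesten's Prop. 2.3 — **the event `{lowest = c}` is determined by the sites of
  `lower c`** (`lowest_congr`: two configurations agreeing on `c ∪ below c` have the same
  answer).
* `lowestSeq ω u` — **the exploration sequence** `c₀ < c₁ < ⋯` (the lowest open crossing, then
  the lowest open crossing of the configuration with `lower c₀` closed, …; Nolin 2008, proof of
  Lemma 15): consecutive terms are disjoint and increasing (`lowestSeq_succ_subset_above`),
  the event `{lowestSeq u = c}` is determined by `lower c` (`lowestSeq_congr`,
  `determinedBy_lowestSeq_eq`), the terms are pairwise disjoint open crossings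
  (`lowestSeq_disjoint_of_lt`, `exists_disjoint_family_of_lowestSeq`: if the `u`-th term exists
  there are `u + 1` disjoint open crossings — the input of the BK inequality in Nolin's bound
  `P(t ≥ T) ≤ (1 - δ')^T`), the sequence terminates (`lowestSeq_eq_none_of_card_lt`), and it is
  **maximal**: every open crossing meets one of its terms (`exists_lowestSeq_inter_nonempty`).

Colours: "open" means `c ⊆ ω`; the closed (white) version is obtained by applying the results
to `ωᶜ`.

## References

* H. Kesten, *Percolation theory for mathematicians*, Birkhäuser (1982), §2.2–2.3, Prop. 2.3
  (lowest occupied crosscut; measurability with respect to the sites on or below it). [KestenPTM1982]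
* P. Nolin, *Near-critical percolation in two dimensions*, Electron. J. Probab. 13 (2008),
  §4.4, Lemma 15 and proof of Thm. 11 [arXiv 0711.4948: Lemma 14, Thm. 10]. [Nolin2008]
* H. Kesten, *Scaling relations for 2D-percolation*, Comm. Math. Phys. 109 (1987), Lemma 2
  (well-separated crossings). [Kesten1987]
* B. Bollobás, O. Riordan, *Percolation*, CUP (2006), Ch. 7, Lemma 5 (duality in marked
  domains). [BollobasRiordan2006]

Mathlib search: Mathlib has `SimpleGraph.Walk`, `Relation.ReflTransGen`, `Finset.exists_min_image`,
`Encodable (Finset _)`, `Prod.Lex`; no percolation / lowest-crossing notions (`rg -i "lowest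
crossing|crosscut"` in Mathlib: nothing). Tree: `PathIn` with `exit`, `last_exit`, `exists_support`
(`SitePaths.lean`, `TriRSWChaining.lean`); the tree's `LowestCrossing.lean` treats the bond model on
`ℤ²` through its dual and is not reusable for site percolation on `𝕋`.
-/

noncomputable section

namespace Literature.Probability.Percolation

open LatticeModels

/-! ### Domains with a tip arc -/

/-- A finite lattice domain `D ⊆ 𝕋` with a **tip arc** `J` (linearly ordered by the height `ht`),
a **start set** `F`, and two reference arcs `Bt` (below `J`) and `Tp` (above `J`): the abstract
data of a "U-shaped region" in which crossings from `F` to `J` are explored from below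
(Nolin 2008, §4.4, the regions `U^{i,ext}_N`, `U^{i,int}_N`; Kesten 1982, §2.3). [cite: Nolin2008, §4.4 (arXiv 0711.4948: Lemma 14)] -/
structure JDomain where
  /-- The sites of the domain. -/
  D : Finset (Site 2)
  /-- The tip arc: crossings end on `J` (and meet it only at their end). -/
  J : Finset (Site 2)
  /-- The start set: crossings contain a site of `F`. -/
  F : Finset (Site 2)
  /-- The upper reference arc. -/
  Tp : Finset (Site 2)
  /-- The lower reference arc. -/
  Bt : Finset (Site 2)
  /-- The height, ordering the tip arc. -/
  ht : Site 2 → ℤ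
  J_subset : J ⊆ D
  F_subset : F ⊆ D
  Tp_subset : Tp ⊆ D
  Bt_subset : Bt ⊆ D
  ht_injOn : Set.InjOn ht ↑J

namespace JDomain

variable (Q : JDomain)

/-- **A crossing with tip `z`**: a `𝕋`-connected set of sites `c ⊆ D` containing a start site
(`c ∩ F ≠ ∅`) and meeting the tip arc exactly at `z` (Kesten 1982, §2.3, crosscuts; Nolin 2008,
§4.2, crossings of a parallelogram with their extremity `z_i`). Only connectivity is retained
of the printed self-avoiding paths. [cite: KestenPTM1982, §2.3] -/
structure IsCrossing (c : Finset (Site 2)) (z : Site 2) : Prop where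
  subset : c ⊆ Q.D
  tip_mem : z ∈ c
  tip_mem_J : z ∈ Q.J
  eq_tip : ∀ v ∈ c, v ∈ Q.J → v = z
  exists_start : ∃ f ∈ c, f ∈ Q.F
  conn : ∀ u ∈ c, ∀ v ∈ c, PathIn triGraph (↑c : Set (Site 2)) u v

/-- The part of the tip arc strictly above height `ht z`. [cite: KestenPTM1982, §2.3] -/
def Jabove (z : Site 2) : Finset (Site 2) := Q.J.filter fun j => Q.ht z < Q.ht j

/-- The part of the tip arc strictly below height `ht z`. [cite: KestenPTM1982, §2.3] -/
def Jbelow (z : Site 2) : Finset (Site 2) := Q.J.filter fun j => Q.ht j < Q.ht z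

/-- The reference set of a crossing: the sites of `J_{>z} ∪ Tp` off the crossing. [cite: KestenPTM1982, §2.3] -/
def ref (c : Finset (Site 2)) (z : Site 2) : Finset (Site 2) := (Q.Jabove z ∪ Q.Tp) \ c

open Classical in
/-- **The region above a crossing**: the sites of `D ∖ c` joined inside `D ∖ c` to the reference
set `(J_{>z} ∪ Tp) ∖ c` (Kesten 1982, §2.3, the component "above" a crosscut; Nolin 2008, §4.4,
"the sites above `c̃_u`"). [cite: KestenPTM1982, §2.3] -/
def above (c : Finset (Site 2)) (z : Site 2) : Finset (Site 2) :=
  (Q.D \ c).filter fun v => ∃ r ∈ Q.ref c z, PathIn triGraph (↑(Q.D \ c) : Set (Site 2)) v r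

/-- **The region below a crossing**: the rest of `D ∖ c`. [cite: KestenPTM1982, §2.3] -/
def below (c : Finset (Site 2)) (z : Site 2) : Finset (Site 2) := (Q.D \ c) \ Q.above c z

/-- **On or below a crossing**: `c ∪ below c`, the set of sites on which the event "`c` is the
lowest crossing" depends (Kesten 1982, Prop. 2.3). [cite: KestenPTM1982, §2.3 Prop. 2.3] -/
def lower (c : Finset (Site 2)) (z : Site 2) : Finset (Site 2) := c ∪ Q.below c z

/-- **Hypothesis (H1): crossings cut the domain.** No path of `D ∖ c` joins `Bt ∪ J_{<z}` to
`Tp ∪ J_{>z}` when `c` is a crossing with tip `z` (planarity; in print the Jordan curve theorem,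
on `𝕋` a consequence of `PathIn.tri_crossings_meet` for the concrete regions). [cite: KestenPTM1982, §2.3] -/
def CutProp (Q : JDomain) : Prop :=
  ∀ ⦃c : Finset (Site 2)⦄ ⦃z : Site 2⦄, Q.IsCrossing c z →
    ∀ s ∈ Q.Bt ∪ Q.Jbelow z, ∀ e ∈ Q.Tp ∪ Q.Jabove z,
      ¬ PathIn triGraph (↑(Q.D \ c) : Set (Site 2)) s e

/-- **Hypothesis (H2): duality.** For every `S ⊆ D`, either `S` contains a `𝕋`-path from `F` to
`J`, or `D ∖ S` contains a `𝕋`-path from `Bt` to `Tp` (the self-matching property of `𝕋`: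
Bollobás–Riordan 2006, Ch. 7, Lemma 5; Kesten 1982, §2.2; for parallelograms the tree's
`triLRCrossing_or_compl_triTBCrossing`). [cite: BollobasRiordan2006, Ch. 7 Lemma 5 p. 169] -/
def DualProp (Q : JDomain) : Prop :=
  ∀ S : Finset (Site 2), S ⊆ Q.D →
    (∃ f ∈ Q.F, ∃ z ∈ Q.J, PathIn triGraph (↑S : Set (Site 2)) f z) ∨
    (∃ s ∈ Q.Bt, ∃ e ∈ Q.Tp, PathIn triGraph (↑(Q.D \ S) : Set (Site 2)) s e)

variable {Q}

/-! ### Basic calculus of `above` / `below` -/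

section Basic

variable {c : Finset (Site 2)} {z v w : Site 2}

/-- Membership in `J_{>z}`. [folklore] -/
@[simp] theorem mem_Jabove {j : Site 2} : j ∈ Q.Jabove z ↔ j ∈ Q.J ∧ Q.ht z < Q.ht j := by
  simp [Jabove]

/-- Membership in `J_{<z}`. [folklore] -/
@[simp] theorem mem_Jbelow {j : Site 2} : j ∈ Q.Jbelow z ↔ j ∈ Q.J ∧ Q.ht j < Q.ht z := by
  simp [Jbelow]

/-- Membership in the reference set. [folklore] -/
theorem mem_ref {r : Site 2} : r ∈ Q.ref c z ↔ (r ∈ Q.Jabove z ∨ r ∈ Q.Tp) ∧ r ∉ c := by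
  simp [ref]

/-- Membership in the region above a crossing, unfolded. [cite: KestenPTM1982, §2.3] -/
theorem mem_above : v ∈ Q.above c z ↔
    v ∈ Q.D ∧ v ∉ c ∧ ∃ r ∈ Q.ref c z, PathIn triGraph (↑(Q.D \ c) : Set (Site 2)) v r := by
  classical
  simp [above, and_assoc]

/-- Membership in the region below a crossing, unfolded. [cite: KestenPTM1982, §2.3] -/
theorem mem_below : v ∈ Q.below c z ↔ v ∈ Q.D ∧ v ∉ c ∧ v ∉ Q.above c z := by
  simp [below, and_assoc]

/-- Membership in the region on or below a crossing, unfolded. [cite: KestenPTM1982, §2.3] -/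
theorem mem_lower : v ∈ Q.lower c z ↔ v ∈ c ∨ v ∈ Q.below c z := by
  simp [lower]

/-- The set of sites of `D ∖ c`. [folklore] -/
theorem coe_sdiff_eq : (↑(Q.D \ c) : Set (Site 2)) = {x | x ∈ Q.D ∧ x ∉ c} := by
  ext x; simp

/-- `above ⊆ D`. [folklore] -/
theorem above_subset_D : Q.above c z ⊆ Q.D := fun _ hv => (mem_above.1 hv).1

/-- `below ⊆ D`. [folklore] -/
theorem below_subset_D : Q.below c z ⊆ Q.D := fun _ hv => (mem_below.1 hv).1

/-- Sites above are off the crossing. [folklore] -/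
theorem not_mem_of_mem_above (hv : v ∈ Q.above c z) : v ∉ c := (mem_above.1 hv).2.1

/-- Sites below are off the crossing. [folklore] -/
theorem not_mem_of_mem_below (hv : v ∈ Q.below c z) : v ∉ c := (mem_below.1 hv).2.1

/-- `above` and `below` are disjoint. [folklore] -/
theorem disjoint_above_below : Disjoint (Q.above c z) (Q.below c z) :=
  Finset.disjoint_left.2 fun _ ha hb => (mem_below.1 hb).2.2 ha

/-- The reference set lies in `D`. [folklore] -/
theorem ref_subset_D : Q.ref c z ⊆ Q.D := by
  intro r hr
  rcases (mem_ref.1 hr).1 with h | h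
  · exact Q.J_subset (mem_Jabove.1 h).1
  · exact Q.Tp_subset h

/-- The reference set lies above. [cite: KestenPTM1982, §2.3] -/
theorem ref_subset_above : Q.ref c z ⊆ Q.above c z := by
  intro r hr
  have hrD : r ∈ Q.D := ref_subset_D hr
  have hrc : r ∉ c := (mem_ref.1 hr).2
  exact mem_above.2 ⟨hrD, hrc, r, hr, PathIn.refl (by simp [hrD, hrc])⟩

/-- `above` is closed under paths of `D ∖ c` (backwards). [cite: KestenPTM1982, §2.3] -/
theorem mem_above_of_pathIn (hw : w ∈ Q.above c z)
    (hp : PathIn triGraph (↑(Q.D \ c) : Set (Site 2)) v w) : v ∈ Q.above c z := by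
  obtain ⟨-, -, r, hr, hq⟩ := mem_above.1 hw
  have hv : v ∈ (↑(Q.D \ c) : Set (Site 2)) := hp.left_mem
  simp only [Finset.coe_sdiff, Set.mem_sdiff, Finset.mem_coe] at hv
  exact mem_above.2 ⟨hv.1, hv.2, r, hr, hp.trans hq⟩

/-- `above` is closed under paths of `D ∖ c` (forwards). [cite: KestenPTM1982, §2.3] -/
theorem mem_above_of_pathIn' (hv : v ∈ Q.above c z)
    (hp : PathIn triGraph (↑(Q.D \ c) : Set (Site 2)) v w) : w ∈ Q.above c z :=
  mem_above_of_pathIn hv hp.symm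

/-- A neighbour in `D ∖ c` of a site above is above. [cite: KestenPTM1982, §2.3] -/
theorem mem_above_of_adj (hv : v ∈ Q.above c z) (hw : w ∈ Q.D) (hwc : w ∉ c)
    (hadj : triGraph.Adj v w) : w ∈ Q.above c z := by
  have hv' := mem_above.1 hv
  refine mem_above_of_pathIn' hv (PathIn.of_adj ?_ ?_ hadj) <;> simp [hv'.1, hv'.2.1, hw, hwc]

/-- **No edge joins `above` to `below`.** [cite: KestenPTM1982, §2.3] -/
theorem not_adj_above_below (hv : v ∈ Q.above c z) (hw : w ∈ Q.below c z) : ¬ triGraph.Adj v w :=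
  fun hadj => (mem_below.1 hw).2.2 (mem_above_of_adj hv (mem_below.1 hw).1 (mem_below.1 hw).2.1 hadj)

/-- Trichotomy in `D`: on the crossing, above it, or below it. [cite: KestenPTM1982, §2.3] -/
theorem mem_or_mem_above_or_mem_below (hv : v ∈ Q.D) : v ∈ c ∨ v ∈ Q.above c z ∨ v ∈ Q.below c z := by
  by_cases hc : v ∈ c
  · exact Or.inl hc
  by_cases ha : v ∈ Q.above c z
  · exact Or.inr (Or.inl ha)
  · exact Or.inr (Or.inr (mem_below.2 ⟨hv, hc, ha⟩))

/-- A site of `D` is on or below a crossing iff it is not above it. [cite: KestenPTM1982, §2.3] -/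
theorem mem_lower_iff_not_mem_above (hv : v ∈ Q.D) : v ∈ Q.lower c z ↔ v ∉ Q.above c z := by
  rw [mem_lower]
  constructor
  · rintro (h | h) ha
    · exact not_mem_of_mem_above ha h
    · exact (mem_below.1 h).2.2 ha
  · intro ha
    rcases mem_or_mem_above_or_mem_below (c := c) (z := z) hv with h | h | h
    · exact Or.inl h
    · exact absurd h ha
    · exact Or.inr h

/-- `lower = D ∖ above` for `c ⊆ D`. [cite: KestenPTM1982, §2.3] -/
theorem lower_eq_sdiff (hc : c ⊆ Q.D) : Q.lower c z = Q.D \ Q.above c z := by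
  ext v
  simp only [Finset.mem_sdiff]
  constructor
  · intro h
    have hvD : v ∈ Q.D := by
      rcases mem_lower.1 h with h | h
      · exact hc h
      · exact below_subset_D h
    exact ⟨hvD, (mem_lower_iff_not_mem_above hvD).1 h⟩
  · rintro ⟨hvD, ha⟩
    exact (mem_lower_iff_not_mem_above hvD).2 ha

/-- `lower ⊆ D` for `c ⊆ D`. [folklore] -/
theorem lower_subset_D (hc : c ⊆ Q.D) : Q.lower c z ⊆ Q.D := by
  rw [lower_eq_sdiff hc]; exact Finset.sdiff_subset

/-- A path inside `D ∖ c` from a site which is not above stays off `above`. [cite: KestenPTM1982, §2.3] -/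
theorem not_mem_above_of_pathIn (hv : v ∉ Q.above c z)
    (hp : PathIn triGraph (↑(Q.D \ c) : Set (Site 2)) v w) : w ∉ Q.above c z :=
  fun hw => hv (mem_above_of_pathIn hw hp)

end Basic

/-! ### Crossings -/

namespace IsCrossing

variable {c c' : Finset (Site 2)} {z z' v : Site 2}

/-- A crossing is nonempty. [folklore] -/
theorem nonempty (h : Q.IsCrossing c z) : c.Nonempty := ⟨z, h.tip_mem⟩

/-- The tip lies in `D`. [folklore] -/
theorem tip_mem_D (h : Q.IsCrossing c z) : z ∈ Q.D := h.subset h.tip_mem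

/-- The tip is not above. [cite: KestenPTM1982, §2.3] -/
theorem tip_not_mem_above (h : Q.IsCrossing c z) : z ∉ Q.above c z :=
  fun hz => not_mem_of_mem_above hz h.tip_mem

/-- Two crossings with the same underlying set have the same tip. [cite: KestenPTM1982, §2.3] -/
theorem tip_unique (h : Q.IsCrossing c z) (h' : Q.IsCrossing c z') : z = z' :=
  h'.eq_tip z h.tip_mem h.tip_mem_J

/-- A site of `J` on a crossing is its tip; contrapositive form. [cite: KestenPTM1982, §2.3] -/
theorem not_mem_of_mem_J_of_ne (h : Q.IsCrossing c z) (hv : v ∈ Q.J) (hvz : v ≠ z) : v ∉ c :=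
  fun hvc => hvz (h.eq_tip v hvc hv)

/-- Sites of `J` strictly above the tip which are off the crossing are above it. [cite: KestenPTM1982, §2.3] -/
theorem mem_above_of_mem_Jabove (h : Q.IsCrossing c z) (hv : v ∈ Q.Jabove z) : v ∈ Q.above c z := by
  have hv' := mem_Jabove.1 hv
  have hvz : v ≠ z := fun e => by rw [e] at hv'; exact lt_irrefl _ hv'.2
  exact ref_subset_above (mem_ref.2 ⟨Or.inl hv, h.not_mem_of_mem_J_of_ne hv'.1 hvz⟩)

/-- Sites of `Tp` off the crossing are above it. [cite: KestenPTM1982, §2.3] -/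
theorem mem_above_of_mem_Tp (_h : Q.IsCrossing c z) (hv : v ∈ Q.Tp) (hvc : v ∉ c) : v ∈ Q.above c z :=
  ref_subset_above (mem_ref.2 ⟨Or.inr hv, hvc⟩)

/-- Under `CutProp`, sites of `Bt ∪ J_{<z}` are never above. [cite: KestenPTM1982, §2.3] -/
theorem not_mem_above_of_mem_Bt_union (hcut : Q.CutProp) (h : Q.IsCrossing c z)
    (hv : v ∈ Q.Bt ∪ Q.Jbelow z) : v ∉ Q.above c z := by
  intro hva
  obtain ⟨-, -, r, hr, hp⟩ := mem_above.1 hva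
  have hr' : r ∈ Q.Tp ∪ Q.Jabove z := by
    rcases (mem_ref.1 hr).1 with h1 | h1
    · exact Finset.mem_union_right _ h1
    · exact Finset.mem_union_left _ h1
  exact hcut h v hv r hr' hp

/-- A connected set off a crossing lies entirely above it or entirely off `above`. [cite: KestenPTM1982, §2.3] -/
theorem subset_above_or_disjoint (_h : Q.IsCrossing c z) (hc'D : c' ⊆ Q.D)
    (hconn : ∀ u ∈ c', ∀ v ∈ c', PathIn triGraph (↑c' : Set (Site 2)) u v) (hdisj : Disjoint c' c) :
    c' ⊆ Q.above c z ∨ Disjoint c' (Q.above c z) := by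
  by_cases hex : ∃ u ∈ c', u ∈ Q.above c z
  · left
    obtain ⟨u, hu, hua⟩ := hex
    intro v hv
    have hp : PathIn triGraph (↑c' : Set (Site 2)) v u := hconn v hv u hu
    refine mem_above_of_pathIn hua (hp.mono ?_)
    intro x hx
    simp only [Finset.coe_sdiff, Set.mem_sdiff, Finset.mem_coe]
    exact ⟨hc'D hx, Finset.disjoint_left.1 hdisj hx⟩
  · right
    push Not at hex
    exact Finset.disjoint_left.2 fun u hu hua => hex u hu hua

/-- **Comparability of disjoint crossings** (under `CutProp`): if the tip of `c'` is higher than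
the tip of `c` and the crossings are disjoint, then `c'` lies above `c` and `c` lies below `c'`
(Kesten 1982, §2.3: disjoint crosscuts are ordered). [cite: KestenPTM1982, §2.3] -/
theorem compare (hcut : Q.CutProp) (h : Q.IsCrossing c z) (h' : Q.IsCrossing c' z')
    (hdisj : Disjoint c c') (hlt : Q.ht z < Q.ht z') :
    c' ⊆ Q.above c z ∧ c ⊆ Q.below c' z' := by
  have hz' : z' ∈ Q.above c z := h.mem_above_of_mem_Jabove (mem_Jabove.2 ⟨h'.tip_mem_J, hlt⟩)
  have h1 : c' ⊆ Q.above c z := by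
    rcases h.subset_above_or_disjoint h'.subset h'.conn hdisj.symm with hh | hh
    · exact hh
    · exact absurd hz' (Finset.disjoint_left.1 hh h'.tip_mem)
  refine ⟨h1, fun v hv => mem_below.2 ⟨h.subset hv, Finset.disjoint_left.1 hdisj hv, fun hva => ?_⟩⟩
  -- if some site of `c` were above `c'`, all of `c` would be, including `z ∈ J_{<z'}`
  rcases h'.subset_above_or_disjoint h.subset h.conn hdisj with hh | hh
  · have hz : z ∈ Q.above c' z' := hh h.tip_mem
    exact h'.not_mem_above_of_mem_Bt_union hcut
      (Finset.mem_union_right _ (mem_Jbelow.2 ⟨h.tip_mem_J, hlt⟩)) hz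
  · exact Finset.disjoint_left.1 hh hv hva

/-- **The potential strictly decreases downwards**: if the crossing `a` lies in the region below
the crossing `c`, then `above c ⊊ above a`. [cite: KestenPTM1982, §2.3] -/
theorem above_ssubset_above_of_subset_below (ha : Q.IsCrossing c' z') (h : Q.IsCrossing c z)
    (hsub : c' ⊆ Q.below c z) : Q.above c z ⊂ Q.above c' z' := by
  have hdisj : Disjoint c' c := Finset.disjoint_left.2 fun v hv => not_mem_of_mem_below (hsub hv)
  -- the tip of `a` is strictly lower than the tip of `c`
  have hz'J : z' ∈ Q.J := ha.tip_mem_J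
  have hz'b : z' ∈ Q.below c z := hsub ha.tip_mem
  have hne : z' ≠ z := fun e => not_mem_of_mem_below hz'b (e ▸ h.tip_mem)
  have hlt : Q.ht z' < Q.ht z := by
    rcases lt_trichotomy (Q.ht z') (Q.ht z) with hh | hh | hh
    · exact hh
    · exact absurd (Q.ht_injOn (Finset.mem_coe.2 hz'J) (Finset.mem_coe.2 h.tip_mem_J) hh) hne
    · exact absurd (h.mem_above_of_mem_Jabove (mem_Jabove.2 ⟨hz'J, hh⟩)) (mem_below.1 hz'b).2.2
  rw [Finset.ssubset_iff_subset_ne]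
  refine ⟨fun v hv => ?_, fun heq => ?_⟩
  · obtain ⟨hvD, hvc, r, hr, hp⟩ := mem_above.1 hv
    -- the path stays above `c`, hence avoids `a ⊆ below c`
    have hp' : PathIn triGraph (↑(Q.D \ c') : Set (Site 2)) v r := by
      obtain ⟨S, hSA, hS, hSall⟩ := hp.exists_support
      refine hS.mono fun x hx => ?_
      have hxa : x ∈ Q.above c z := mem_above_of_pathIn' hv ((hSall x hx).mono hSA)
      simp only [Finset.coe_sdiff, Set.mem_sdiff, Finset.mem_coe]
      exact ⟨above_subset_D hxa, fun hxc' => (mem_below.1 (hsub hxc')).2.2 hxa⟩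
    have hra : r ∈ Q.above c z := ref_subset_above hr
    have hrc' : r ∉ c' := fun hrc' => (mem_below.1 (hsub hrc')).2.2 hra
    have hr' : r ∈ Q.ref c' z' := by
      refine mem_ref.2 ⟨?_, hrc'⟩
      rcases (mem_ref.1 hr).1 with h1 | h1
      · exact Or.inl (mem_Jabove.2 ⟨(mem_Jabove.1 h1).1, hlt.trans (mem_Jabove.1 h1).2⟩)
      · exact Or.inr h1
    have hva : v ∉ c' := fun hvc' => (mem_below.1 (hsub hvc')).2.2 hv
    exact mem_above.2 ⟨hvD, hva, r, hr', hp'⟩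
  · -- `z` is above `a` but not above `c`
    have hz : z ∈ Q.above c' z' :=
      ha.mem_above_of_mem_Jabove (mem_Jabove.2 ⟨h.tip_mem_J, hlt⟩)
    rw [← heq] at hz
    exact h.tip_not_mem_above hz

end IsCrossing

/-! ### Extracting crossings from paths -/

/-- **A path of `S ⊆ D` from `F` to `J` contains a crossing inside `S`** (stop the path at its
first visit to `J` and take its set of sites). [cite: KestenPTM1982, §2.3] -/
theorem exists_crossing_subset {S : Finset (Site 2)} (hSD : S ⊆ Q.D) {f t : Site 2} (hf : f ∈ Q.F)
    (ht : t ∈ Q.J) (hp : PathIn triGraph (↑S : Set (Site 2)) f t) :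
    ∃ c z, Q.IsCrossing c z ∧ c ⊆ S := by
  classical
  by_cases hfJ : f ∈ Q.J
  · refine ⟨{f}, f, ⟨?_, by simp, hfJ, by simp, ⟨f, by simp, hf⟩, ?_⟩, ?_⟩
    · simpa using hSD hp.left_mem
    · intro u hu v hv
      simp only [Finset.mem_singleton] at hu hv
      subst hu; subst hv
      exact PathIn.refl (by simp)
    · simpa using hp.left_mem
  -- first visit to `J`
  obtain ⟨a, b, -, hbJ, hbS, hab, hq⟩ := hp.exit (R := {x | x ∉ Q.J}) hfJ (fun h => h ht)
  simp only [Set.mem_setOf_eq, not_not] at hbJ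
  obtain ⟨T, hTA, hT, hTall⟩ := hq.exists_support
  have hTfin : T.Finite := (S.finite_toSet.inter_of_right {x | x ∉ Q.J}).subset hTA
  set c : Finset (Site 2) := insert b hTfin.toFinset with hc
  have hmemc : ∀ {x}, x ∈ c ↔ x = b ∨ x ∈ T := by
    intro x; simp [hc]
  have hcS : c ⊆ S := by
    intro x hx
    rcases hmemc.1 hx with rfl | hx
    · exact hbS
    · exact (hTA hx).2
  refine ⟨c, b, ⟨hcS.trans hSD, hmemc.2 (Or.inl rfl), hbJ, ?_, ⟨f, hmemc.2 (Or.inr hT.left_mem), hf⟩, ?_⟩, hcS⟩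
  · intro v hv hvJ
    rcases hmemc.1 hv with h | h
    · exact h
    · exact absurd hvJ (hTA h).1
  · -- connectivity through `f`
    have hTc : T ⊆ (↑c : Set (Site 2)) := fun x hx => Finset.mem_coe.2 (hmemc.2 (Or.inr hx))
    have hfrom : ∀ x ∈ c, PathIn triGraph (↑c : Set (Site 2)) f x := by
      intro x hx
      rcases hmemc.1 hx with rfl | hxT
      · exact (hT.mono hTc).tail hab (Finset.mem_coe.2 (hmemc.2 (Or.inl rfl)))
      · exact (hTall x hxT).mono hTc
    intro u hu v hv
    exact (hfrom u hu).symm.trans (hfrom v hv)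

/-! ### The lower envelope of two crossings -/

/-- **The lower envelope.** Under `CutProp` and `DualProp`, for two crossings `K`, `K'` the set
`(K ∖ above K') ∪ (K' ∖ above K)` contains a crossing, and every crossing inside it has `above`
containing `above K ∪ above K'` (the "lower envelope" of two crosscuts is a crosscut below both;
Kesten 1982, §2.3). Proof: otherwise, by duality, a path of the complement joins `Bt` to `Tp`;
walking along it, one never enters `above K ∪ above K'` (entering `above K` requires standing on
`K`, where being off the envelope means being above `K'` — impossible from outside `above K'`),
but it ends on `Tp`, which is above. [cite: KestenPTM1982, §2.3] -/
theorem exists_crossing_envelope (hcut : Q.CutProp) (hdual : Q.DualProp) {K K' : Finset (Site 2)}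
    {z z' : Site 2} (hK : Q.IsCrossing K z) (hK' : Q.IsCrossing K' z') :
    ∃ E w, Q.IsCrossing E w ∧ E ⊆ (K \ Q.above K' z') ∪ (K' \ Q.above K z) := by
  classical
  set S : Finset (Site 2) := (K \ Q.above K' z') ∪ (K' \ Q.above K z) with hS
  have hSD : S ⊆ Q.D := by
    intro x hx
    rcases Finset.mem_union.1 hx with h | h
    · exact hK.subset (Finset.mem_sdiff.1 h).1
    · exact hK'.subset (Finset.mem_sdiff.1 h).1
  rcases hdual S hSD with ⟨f, hf, t, ht, hp⟩ | ⟨s, hs, e, he, hp⟩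
  · exact exists_crossing_subset hSD hf ht hp
  · exfalso
    -- invariant along the dual path: never above `K`, never above `K'`
    have key : ∀ x, PathIn triGraph (↑(Q.D \ S) : Set (Site 2)) s x →
        x ∉ Q.above K z ∧ x ∉ Q.above K' z' := by
      intro x hx
      obtain ⟨hs0, hsx⟩ := hx
      induction hsx with
      | refl =>
        exact ⟨hK.not_mem_above_of_mem_Bt_union hcut (Finset.mem_union_left _ hs),
          hK'.not_mem_above_of_mem_Bt_union hcut (Finset.mem_union_left _ hs)⟩
      | @tail b d _ hbd ih =>
        obtain ⟨ihK, ihK'⟩ := ih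
        have hbDS : b ∈ (↑(Q.D \ S) : Set (Site 2)) := (show PathIn triGraph _ s b from ⟨hs0, ‹_›⟩).right_mem
        simp only [Finset.coe_sdiff, Set.mem_sdiff, Finset.mem_coe] at hbDS
        have hdDS := hbd.2
        simp only [Finset.coe_sdiff, Set.mem_sdiff, Finset.mem_coe] at hdDS
        have hbS : b ∉ S := hbDS.2
        constructor
        · intro hdA
          -- `b` adjacent to a site above `K`: either `b ∈ K` or `b` above `K`
          by_cases hbK : b ∈ K
          · -- `b ∈ K ∖ S` forces `b ∈ above K'`
            apply ihK'
            by_contra hbA'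
            exact hbS (Finset.mem_union_left _ (Finset.mem_sdiff.2 ⟨hbK, hbA'⟩))
          · exact ihK (mem_above_of_adj hdA hbDS.1 hbK hbd.1.symm)
        · intro hdA'
          by_cases hbK' : b ∈ K'
          · apply ihK
            by_contra hbA
            exact hbS (Finset.mem_union_right _ (Finset.mem_sdiff.2 ⟨hbK', hbA⟩))
          · exact ihK' (mem_above_of_adj hdA' hbDS.1 hbK' hbd.1.symm)
    obtain ⟨heK, heK'⟩ := key e hp
    have heDS := hp.right_mem
    simp only [Finset.coe_sdiff, Set.mem_sdiff, Finset.mem_coe] at heDS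
    by_cases heKm : e ∈ K
    · -- `e ∈ K ∖ S` ⇒ `e ∈ above K'`
      apply heK'
      by_contra h'
      exact heDS.2 (Finset.mem_union_left _ (Finset.mem_sdiff.2 ⟨heKm, h'⟩))
    · exact heK (hK.mem_above_of_mem_Tp he heKm)

/-- **Crossings inside the envelope lie below both.** [cite: KestenPTM1982, §2.3] -/
theorem above_subset_above_of_subset_envelope {K K' E : Finset (Site 2)}
    {z z' w : Site 2} (hK : Q.IsCrossing K z) (hE : Q.IsCrossing E w)
    (hEsub : E ⊆ (K \ Q.above K' z') ∪ (K' \ Q.above K z)) : Q.above K z ⊆ Q.above E w := by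
  classical
  -- `S ∩ above K = ∅`
  have hSA : ∀ x ∈ (K \ Q.above K' z') ∪ (K' \ Q.above K z), x ∉ Q.above K z := by
    intro x hx hxA
    rcases Finset.mem_union.1 hx with h | h
    · exact not_mem_of_mem_above hxA (Finset.mem_sdiff.1 h).1
    · exact (Finset.mem_sdiff.1 h).2 hxA
  -- the tip `w` of `E` lies on `J ∩ S ⊆ {z, z'}`; heights: `ht w ≤ ht z`
  have hwle : Q.ht w ≤ Q.ht z := by
    have hwS := hEsub hE.tip_mem
    by_contra hlt
    push Not at hlt
    have hwJa : w ∈ Q.Jabove z := mem_Jabove.2 ⟨hE.tip_mem_J, hlt⟩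
    rcases Finset.mem_union.1 hwS with h | h
    · -- `w ∈ K ∩ J` ⇒ `w = z`
      have := hK.eq_tip w (Finset.mem_sdiff.1 h).1 hE.tip_mem_J
      rw [this] at hlt; exact lt_irrefl _ hlt
    · exact (Finset.mem_sdiff.1 h).2 (hK.mem_above_of_mem_Jabove hwJa)
  intro v hv
  obtain ⟨hvD, -, r, hr, hp⟩ := mem_above.1 hv
  -- the path stays in `above K`, hence avoids `S ⊇ E`
  obtain ⟨T, hTA, hT, hTall⟩ := hp.exists_support
  have hTabove : ∀ x ∈ T, x ∈ Q.above K z := fun x hx => mem_above_of_pathIn' hv ((hTall x hx).mono hTA)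
  have hp' : PathIn triGraph (↑(Q.D \ E) : Set (Site 2)) v r := by
    refine hT.mono fun x hx => ?_
    simp only [Finset.coe_sdiff, Set.mem_sdiff, Finset.mem_coe]
    exact ⟨above_subset_D (hTabove x hx), fun hxE => hSA x (hEsub hxE) (hTabove x hx)⟩
  have hvE : v ∉ E := fun hvE => hSA v (hEsub hvE) hv
  have hrE : r ∉ E := fun hrE => hSA r (hEsub hrE) (ref_subset_above hr)
  have hr' : r ∈ Q.ref E w := by
    refine mem_ref.2 ⟨?_, hrE⟩
    rcases (mem_ref.1 hr).1 with h1 | h1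
    · exact Or.inl (mem_Jabove.2 ⟨(mem_Jabove.1 h1).1, lt_of_le_of_lt hwle (mem_Jabove.1 h1).2⟩)
    · exact Or.inr h1
  exact mem_above.2 ⟨hvD, hvE, r, hr', hp'⟩

/-! ### The lowest open crossing -/

section Lowest

variable (Q)

/-- The **potential** of a crossing: the number of sites of the domain not above it
(`= #(c ∪ below c)` for `c ⊆ D`); the lowest crossing minimises it. [cite: KestenPTM1982, §2.3 Prop. 2.3] -/
def pot (c : Finset (Site 2)) (z : Site 2) : ℕ := (Q.D \ Q.above c z).card

/-- The sort key of a crossing: its potential, ties broken by a fixed enumeration of the finite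
sets of sites. [cite: KestenPTM1982, §2.3 Prop. 2.3] -/
def key (p : Finset (Site 2) × Site 2) : ℕ ×ₗ ℕ := toLex (Q.pot p.1 p.2, Encodable.encode p.1)

open Classical in
/-- The open crossings of the configuration `ω` (as pairs (set of sites, tip)). [cite: KestenPTM1982, §2.3] -/
def openCrossings (ω : Set (Site 2)) : Finset (Finset (Site 2) × Site 2) :=
  (Q.D.powerset ×ˢ Q.J).filter fun p => Q.IsCrossing p.1 p.2 ∧ (↑p.1 : Set (Site 2)) ⊆ ω

open Classical in
/-- **The lowest open crossing** of `ω` (Kesten 1982, Prop. 2.3, "the lowest occupied crosscut";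
Nolin 2008, proof of Lemma 15, "`c₁` the lowest monochromatic crossing"): the open crossing of
least potential (least sort key), `none` if there is no open crossing. [cite: KestenPTM1982, §2.3 Prop. 2.3] -/
def lowest (ω : Set (Site 2)) : Option (Finset (Site 2) × Site 2) :=
  if h : (Q.openCrossings ω).Nonempty then
    some (Classical.choose (Finset.exists_min_image (Q.openCrossings ω) Q.key h))
  else none

variable {Q}

variable {ω ω' : Set (Site 2)} {c a : Finset (Site 2)} {z w : Site 2} {p p' : Finset (Site 2) × Site 2}

/-- Membership in `openCrossings`, unfolded. [folklore] -/
theorem mem_openCrossings : p ∈ Q.openCrossings ω ↔ Q.IsCrossing p.1 p.2 ∧ (↑p.1 : Set (Site 2)) ⊆ ω := by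
  classical
  simp only [openCrossings, Finset.mem_filter, Finset.mem_product, Finset.mem_powerset, and_iff_right_iff_imp]
  exact fun h => ⟨h.1.subset, h.1.tip_mem_J⟩

/-- The sort key is injective on crossings. [cite: KestenPTM1982, §2.3 Prop. 2.3] -/
theorem eq_of_key_eq (hp : Q.IsCrossing p.1 p.2) (hp' : Q.IsCrossing p'.1 p'.2) (h : Q.key p = Q.key p') :
    p = p' := by
  have h1 : p.1 = p'.1 := by
    have : Encodable.encode p.1 = Encodable.encode p'.1 := by
      have := congrArg (fun x => (ofLex x).2) h
      simpa [key] using this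
    exact Encodable.encode_injective this
  obtain ⟨c, z⟩ := p
  obtain ⟨c', z'⟩ := p'
  simp only at h1 hp hp'
  subst h1
  simp [hp.tip_unique hp']

/-- **Characterisation of the lowest crossing**: `lowest ω = p` iff `p` is an open crossing of
least key. [cite: KestenPTM1982, §2.3 Prop. 2.3] -/
theorem lowest_eq_some_iff : Q.lowest ω = some p ↔
    p ∈ Q.openCrossings ω ∧ ∀ p' ∈ Q.openCrossings ω, Q.key p ≤ Q.key p' := by
  classical
  unfold lowest
  split_ifs with h
  · have hspec := Classical.choose_spec (Finset.exists_min_image (Q.openCrossings ω) Q.key h)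
    set q := Classical.choose (Finset.exists_min_image (Q.openCrossings ω) Q.key h)
    constructor
    · intro hq
      have : q = p := Option.some_injective _ hq
      subst this
      exact hspec
    · rintro ⟨hp, hmin⟩
      congr 1
      have hle1 : Q.key q ≤ Q.key p := hspec.2 p hp
      have hle2 : Q.key p ≤ Q.key q := hmin q hspec.1
      exact eq_of_key_eq (mem_openCrossings.1 hspec.1).1 (mem_openCrossings.1 hp).1 (le_antisymm hle1 hle2)
  · simp only [false_iff, not_and]
    intro hp
    exact absurd ⟨p, hp⟩ h

/-- The lowest crossing is an open crossing. [cite: KestenPTM1982, §2.3 Prop. 2.3] -/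
theorem isCrossing_of_lowest (h : Q.lowest ω = some (c, z)) : Q.IsCrossing c z ∧ (↑c : Set (Site 2)) ⊆ ω :=
  mem_openCrossings.1 (lowest_eq_some_iff.1 h).1

/-- **Existence**: if there is an open crossing, there is a lowest one. [cite: KestenPTM1982, §2.3 Prop. 2.3] -/
theorem lowest_ne_none (hc : Q.IsCrossing c z) (hcω : (↑c : Set (Site 2)) ⊆ ω) : Q.lowest ω ≠ none := by
  classical
  unfold lowest
  rw [dif_pos ⟨(c, z), mem_openCrossings.2 ⟨hc, hcω⟩⟩]
  exact Option.some_ne_none _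

/-- There is no lowest crossing iff there is no open crossing. [cite: KestenPTM1982, §2.3 Prop. 2.3] -/
theorem lowest_eq_none_iff : Q.lowest ω = none ↔ ∀ c z, Q.IsCrossing c z → ¬ (↑c : Set (Site 2)) ⊆ ω := by
  constructor
  · intro h c z hc hcω
    exact lowest_ne_none hc hcω h
  · intro h
    classical
    unfold lowest
    rw [dif_neg]
    rintro ⟨p, hp⟩
    exact h p.1 p.2 (mem_openCrossings.1 hp).1 (mem_openCrossings.1 hp).2

/-- A crossing strictly below another has strictly smaller potential. [cite: KestenPTM1982, §2.3] -/
theorem pot_lt_pot_of_subset_below (ha : Q.IsCrossing a w) (hc : Q.IsCrossing c z)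
    (hsub : a ⊆ Q.below c z) : Q.pot a w < Q.pot c z := by
  unfold pot
  apply Finset.card_lt_card
  have hss := ha.above_ssubset_above_of_subset_below hc hsub
  rw [Finset.ssubset_iff_subset_ne] at hss ⊢
  refine ⟨Finset.sdiff_subset_sdiff (Finset.Subset.refl _) hss.1, fun heq => hss.2 ?_⟩
  have h1 : Q.D \ (Q.D \ Q.above a w) = Q.D \ (Q.D \ Q.above c z) := by rw [heq]
  rwa [Finset.sdiff_sdiff_eq_self above_subset_D, Finset.sdiff_sdiff_eq_self above_subset_D,
    eq_comm] at h1

/-- **No open crossing lies strictly below the lowest one** (Kesten 1982, Prop. 2.3; Nolin 2008,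
proof of Lemma 15, maximality of the explored family). [cite: KestenPTM1982, §2.3 Prop. 2.3] -/
theorem not_subset_below_lowest (h : Q.lowest ω = some (c, z)) (ha : Q.IsCrossing a w)
    (haω : (↑a : Set (Site 2)) ⊆ ω) : ¬ a ⊆ Q.below c z := by
  intro hsub
  obtain ⟨hp, hmin⟩ := lowest_eq_some_iff.1 h
  have hc : Q.IsCrossing c z := (mem_openCrossings.1 hp).1
  have hle : Q.key (c, z) ≤ Q.key (a, w) := hmin (a, w) (mem_openCrossings.2 ⟨ha, haω⟩)
  have hlt : Q.pot a w < Q.pot c z := pot_lt_pot_of_subset_below ha hc hsub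
  rw [key, key, Prod.Lex.le_iff] at hle
  simp only [ofLex_toLex] at hle
  omega

/-- **Kesten's Prop. 2.3: `{lowest = c}` is determined by the sites on or below `c`.** If
`lowest ω = (c, z)` and `ω'` agrees with `ω` on `lower c z = c ∪ below c z`, then
`lowest ω' = (c, z)` (under `CutProp` and `DualProp`). Proof: an open crossing `c'` of `ω'`
not contained in `lower c` would, with `c`, have a lower envelope `E ⊆ lower c` open in `ω`,
of potential at most those of `c` and `c'`; minimality of `c` in `ω` then forces equal
potentials, equal regions above, and `c' ⊆ lower c` after all. [cite: KestenPTM1982, §2.3 Prop. 2.3] -/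
theorem lowest_congr (hcut : Q.CutProp) (hdual : Q.DualProp) (h : Q.lowest ω = some (c, z))
    (hagree : ∀ v ∈ Q.lower c z, v ∈ ω ↔ v ∈ ω') : Q.lowest ω' = some (c, z) := by
  obtain ⟨hp, hmin⟩ := lowest_eq_some_iff.1 h
  obtain ⟨hc, hcω⟩ := mem_openCrossings.1 hp
  dsimp only at hc hcω
  have hcω' : (↑c : Set (Site 2)) ⊆ ω' := fun v hv =>
    (hagree v (mem_lower.2 (Or.inl (Finset.mem_coe.1 hv)))).1 (hcω hv)
  refine lowest_eq_some_iff.2 ⟨mem_openCrossings.2 ⟨hc, hcω'⟩, fun p' hp' => ?_⟩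
  obtain ⟨hc', hc'ω'⟩ := mem_openCrossings.1 hp'
  obtain ⟨c', z'⟩ := p'
  simp only at hc' hc'ω'
  by_cases hsub : c' ⊆ Q.lower c z
  · -- then `c'` is open in `ω` too
    have hc'ω : (↑c' : Set (Site 2)) ⊆ ω := fun v hv =>
      (hagree v (hsub (Finset.mem_coe.1 hv))).2 (hc'ω' hv)
    exact hmin (c', z') (mem_openCrossings.2 ⟨hc', hc'ω⟩)
  · -- the lower envelope of `c` and `c'`
    obtain ⟨E, w, hE, hEsub⟩ := exists_crossing_envelope hcut hdual hc hc'
    have hEA : Q.above c z ⊆ Q.above E w := above_subset_above_of_subset_envelope hc hE hEsub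
    have hEA' : Q.above c' z' ⊆ Q.above E w := by
      refine above_subset_above_of_subset_envelope (K' := c) (z' := z) hc' hE ?_
      rwa [Finset.union_comm] at hEsub
    -- `E ⊆ lower c` and `E` is open in `ω'`, hence in `ω`
    have hElower : E ⊆ Q.lower c z := by
      intro v hv
      have hvD : v ∈ Q.D := hE.subset hv
      rcases Finset.mem_union.1 (hEsub hv) with h1 | h1
      · exact mem_lower.2 (Or.inl (Finset.mem_sdiff.1 h1).1)
      · exact (mem_lower_iff_not_mem_above hvD).2 (Finset.mem_sdiff.1 h1).2
    have hEω' : (↑E : Set (Site 2)) ⊆ ω' := by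
      intro v hv
      rcases Finset.mem_union.1 (hEsub (Finset.mem_coe.1 hv)) with h1 | h1
      · exact hcω' (Finset.mem_coe.2 (Finset.mem_sdiff.1 h1).1)
      · exact hc'ω' (Finset.mem_coe.2 (Finset.mem_sdiff.1 h1).1)
    have hEω : (↑E : Set (Site 2)) ⊆ ω := fun v hv =>
      (hagree v (hElower (Finset.mem_coe.1 hv))).2 (hEω' hv)
    have hkeyE : Q.key (c, z) ≤ Q.key (E, w) := hmin (E, w) (mem_openCrossings.2 ⟨hE, hEω⟩)
    -- potentials
    have hpotE_c : Q.pot E w ≤ Q.pot c z :=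
      Finset.card_le_card (Finset.sdiff_subset_sdiff (Finset.Subset.refl _) hEA)
    have hpotE_c' : Q.pot E w ≤ Q.pot c' z' :=
      Finset.card_le_card (Finset.sdiff_subset_sdiff (Finset.Subset.refl _) hEA')
    have hpotc_E : Q.pot c z ≤ Q.pot E w := by
      rw [key, key, Prod.Lex.le_iff] at hkeyE
      simp only [ofLex_toLex] at hkeyE
      omega
    change Q.key (c, z) ≤ Q.key (c', z')
    rw [key, key, Prod.Lex.le_iff]
    simp only [ofLex_toLex]
    rcases lt_or_ge (Q.pot c z) (Q.pot c' z') with hlt | hge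
    · exact Or.inl hlt
    · exfalso
      -- all potentials equal, so `above c = above E = above c'`
      have h1 : Q.pot E w = Q.pot c z := le_antisymm hpotE_c hpotc_E
      have h2 : Q.pot E w = Q.pot c' z' := le_antisymm hpotE_c' (hge.trans hpotc_E)
      have hAc : Q.above c z = Q.above E w := by
        refine Finset.eq_of_subset_of_card_le hEA ?_
        have := Finset.card_sdiff_add_card_eq_card (above_subset_D (Q := Q) (c := c) (z := z))
        have := Finset.card_sdiff_add_card_eq_card (above_subset_D (Q := Q) (c := E) (z := w))
        unfold pot at h1
        omega
      have hAc' : Q.above c' z' = Q.above E w := by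
        refine Finset.eq_of_subset_of_card_le hEA' ?_
        have := Finset.card_sdiff_add_card_eq_card (above_subset_D (Q := Q) (c := c') (z := z'))
        have := Finset.card_sdiff_add_card_eq_card (above_subset_D (Q := Q) (c := E) (z := w))
        unfold pot at h2
        omega
      -- hence `c' ⊆ lower c`
      apply hsub
      intro v hv
      have hvD : v ∈ Q.D := hc'.subset hv
      refine (mem_lower_iff_not_mem_above hvD).2 fun hva => ?_
      rw [hAc, ← hAc'] at hva
      exact not_mem_of_mem_above hva hv

end Lowest

/-! ### The exploration sequence -/

section Sequence

variable (Q)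

/-- **The exploration sequence** (Nolin 2008, proof of Lemma 15: "`c₁` the lowest monochromatic
crossing, then `c₂` the lowest monochromatic crossing disjoint from `c₁`, and so on"): the
lowest open crossing of `ω`, then recursively the lowest open crossing of the configuration in
which the sites on or below the previous term are closed. [cite: Nolin2008, §4.4 (arXiv 0711.4948: proof of Lemma 14)] -/
def lowestSeq (ω : Set (Site 2)) : ℕ → Option (Finset (Site 2) × Site 2)
  | 0 => Q.lowest ω
  | u + 1 =>
    match lowestSeq ω u with
    | none => none
    | some p => Q.lowest (ω \ ↑(Q.lower p.1 p.2))

variable {Q}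

variable {ω ω' : Set (Site 2)} {c c' a : Finset (Site 2)} {z z' w : Site 2} {u : ℕ}

/-- The first term is the lowest open crossing. [cite: Nolin2008, §4.4 (arXiv 0711.4948: proof of Lemma 14)] -/
@[simp] theorem lowestSeq_zero : Q.lowestSeq ω 0 = Q.lowest ω := rfl

/-- The recursion of the exploration sequence. [cite: Nolin2008, §4.4 (arXiv 0711.4948: proof of Lemma 14)] -/
theorem lowestSeq_succ : Q.lowestSeq ω (u + 1) =
    match Q.lowestSeq ω u with
    | none => none
    | some p => Q.lowest (ω \ ↑(Q.lower p.1 p.2)) := rfl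

/-- The recursion, when the previous term exists. [cite: Nolin2008, §4.4 (arXiv 0711.4948: proof of Lemma 14)] -/
theorem lowestSeq_succ_of_eq_some (h : Q.lowestSeq ω u = some (c, z)) :
    Q.lowestSeq ω (u + 1) = Q.lowest (ω \ ↑(Q.lower c z)) := by
  rw [lowestSeq_succ, h]

/-- The recursion, when the previous term does not exist. [cite: Nolin2008, §4.4 (arXiv 0711.4948: proof of Lemma 14)] -/
theorem lowestSeq_succ_of_eq_none (h : Q.lowestSeq ω u = none) : Q.lowestSeq ω (u + 1) = none := by
  rw [lowestSeq_succ, h]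

/-- Once the sequence stops it stays stopped. [cite: Nolin2008, §4.4 (arXiv 0711.4948: proof of Lemma 14)] -/
theorem lowestSeq_eq_none_of_le {u v : ℕ} (h : Q.lowestSeq ω u = none) (huv : u ≤ v) : Q.lowestSeq ω v = none := by
  induction huv with
  | refl => exact h
  | step _ ih => exact lowestSeq_succ_of_eq_none ih

/-- A later term exists only if the earlier ones do. [cite: Nolin2008, §4.4 (arXiv 0711.4948: proof of Lemma 14)] -/
theorem exists_lowestSeq_eq_some_of_succ {p : Finset (Site 2) × Site 2} (h : Q.lowestSeq ω (u + 1) = some p) :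
    ∃ q, Q.lowestSeq ω u = some q := by
  cases hu : Q.lowestSeq ω u with
  | none => rw [lowestSeq_succ_of_eq_none hu] at h; exact absurd h (by simp)
  | some q => exact ⟨q, rfl⟩

/-- **Every term of the sequence is an open crossing of `ω`.** [cite: Nolin2008, §4.4 (arXiv 0711.4948: proof of Lemma 14)] -/
theorem isCrossing_of_lowestSeq (h : Q.lowestSeq ω u = some (c, z)) : Q.IsCrossing c z ∧ (↑c : Set (Site 2)) ⊆ ω := by
  cases u with
  | zero => exact isCrossing_of_lowest h
  | succ u =>
    obtain ⟨⟨c₀, z₀⟩, h₀⟩ := exists_lowestSeq_eq_some_of_succ h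
    rw [lowestSeq_succ_of_eq_some h₀] at h
    obtain ⟨hc, hcω⟩ := isCrossing_of_lowest h
    exact ⟨hc, hcω.trans Set.sdiff_subset⟩

/-- **Consecutive terms**: the next term lies above the previous one, which lies below it; in
particular they are disjoint and the regions on-or-below increase. [cite: Nolin2008, §4.4 (arXiv 0711.4948: proof of Lemma 14)] -/
theorem lowestSeq_succ_subset_above (hcut : Q.CutProp) (h : Q.lowestSeq ω u = some (c, z))
    (h' : Q.lowestSeq ω (u + 1) = some (c', z')) :
    c' ⊆ Q.above c z ∧ c ⊆ Q.below c' z' ∧ Q.lower c z ⊆ Q.lower c' z' := by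
  have hc := (isCrossing_of_lowestSeq h).1
  rw [lowestSeq_succ_of_eq_some h] at h'
  obtain ⟨hc', hc'ω⟩ := isCrossing_of_lowest h'
  -- `c'` is open in `ω ∖ lower c`, hence off `lower c`, hence inside `above c`
  have h1 : c' ⊆ Q.above c z := by
    intro v hv
    have hvω := hc'ω (Finset.mem_coe.2 hv)
    have hvl : v ∉ Q.lower c z := fun hvl => hvω.2 (Finset.mem_coe.2 hvl)
    by_contra hva
    exact hvl ((mem_lower_iff_not_mem_above (hc'.subset hv)).2 hva)
  have hdisj : Disjoint c c' := Finset.disjoint_left.2 fun v hv hv' => not_mem_of_mem_above (h1 hv') hv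
  -- tips: `ht z < ht z'` (else comparability the other way round contradicts `h1`)
  have hlt : Q.ht z < Q.ht z' := by
    rcases lt_trichotomy (Q.ht z) (Q.ht z') with hh | hh | hh
    · exact hh
    · exfalso
      have := Q.ht_injOn (Finset.mem_coe.2 hc.tip_mem_J) (Finset.mem_coe.2 hc'.tip_mem_J) hh
      exact Finset.disjoint_left.1 hdisj hc.tip_mem (this ▸ hc'.tip_mem)
    · exfalso
      obtain ⟨hcA, -⟩ := hc'.compare hcut hc hdisj.symm hh
      -- `c ⊆ above c'` and `c' ⊆ above c`: then `z ∈ above c'`, `z' ∈ above c`; but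
      -- `z' ∈ J_{<z}` cannot be above `c`
      exact hc.not_mem_above_of_mem_Bt_union hcut
        (Finset.mem_union_right _ (mem_Jbelow.2 ⟨hc'.tip_mem_J, hh⟩)) (h1 hc'.tip_mem)
  obtain ⟨-, h2⟩ := hc.compare hcut hc' hdisj hlt
  refine ⟨h1, h2, fun v hv => ?_⟩
  have hvD : v ∈ Q.D := lower_subset_D hc.subset hv
  refine (mem_lower_iff_not_mem_above hvD).2 fun hva => ?_
  have hss := hc.above_ssubset_above_of_subset_below hc' h2
  exact (mem_lower_iff_not_mem_above hvD).1 hv (hss.1 hva)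

/-- The regions on-or-below increase along the sequence. [cite: Nolin2008, §4.4 (arXiv 0711.4948: proof of Lemma 14)] -/
theorem lower_subset_lower_of_le (hcut : Q.CutProp) {u v : ℕ} (huv : u ≤ v)
    (h : Q.lowestSeq ω u = some (c, z)) (h' : Q.lowestSeq ω v = some (c', z')) :
    Q.lower c z ⊆ Q.lower c' z' := by
  induction huv generalizing c' z' with
  | refl => rw [h] at h'; cases h'; exact Finset.Subset.refl _
  | @step v _ ih =>
    obtain ⟨⟨c₁, z₁⟩, h₁⟩ := exists_lowestSeq_eq_some_of_succ h'
    exact (ih h₁).trans (lowestSeq_succ_subset_above hcut h₁ h').2.2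

/-- **The terms are pairwise disjoint** (earlier terms lie on-or-below later ones, later terms lie
above earlier ones). [cite: Nolin2008, §4.4 (arXiv 0711.4948: proof of Lemma 14)] -/
theorem lowestSeq_disjoint_of_lt (hcut : Q.CutProp) {u v : ℕ} (huv : u < v)
    (h : Q.lowestSeq ω u = some (c, z)) (h' : Q.lowestSeq ω v = some (c', z')) : Disjoint c c' := by
  obtain ⟨v, rfl⟩ := Nat.exists_eq_add_of_lt huv
  obtain ⟨⟨c₁, z₁⟩, h₁⟩ := exists_lowestSeq_eq_some_of_succ h'
  have hle : u ≤ u + v := Nat.le_add_right u v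
  have hlow : Q.lower c z ⊆ Q.lower c₁ z₁ := lower_subset_lower_of_le hcut hle h h₁
  have hab := (lowestSeq_succ_subset_above hcut h₁ h').1
  refine Finset.disjoint_left.2 fun x hx hx' => ?_
  have hxl : x ∈ Q.lower c₁ z₁ := hlow (mem_lower.2 (Or.inl hx))
  have hc₁ := (isCrossing_of_lowestSeq h₁).1
  exact (mem_lower_iff_not_mem_above (lower_subset_D hc₁.subset hxl)).1 hxl (hab hx')

/-- **The sequence terminates**: the potentials strictly increase, so there are at most `#D + 1`
terms. [cite: Nolin2008, §4.4 (arXiv 0711.4948: proof of Lemma 14)] -/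
theorem pot_lowestSeq_ge (hcut : Q.CutProp) (h : Q.lowestSeq ω u = some (c, z)) : u ≤ Q.pot c z := by
  induction u generalizing c z with
  | zero => exact Nat.zero_le _
  | succ u ih =>
    obtain ⟨⟨c₀, z₀⟩, h₀⟩ := exists_lowestSeq_eq_some_of_succ h
    have h1 := ih h₀
    have h2 := (lowestSeq_succ_subset_above hcut h₀ h).2.1
    have hlt := pot_lt_pot_of_subset_below (isCrossing_of_lowestSeq h₀).1 (isCrossing_of_lowestSeq h).1 h2
    omega

/-- The sequence has at most `#D + 1` terms. [cite: Nolin2008, §4.4 (arXiv 0711.4948: proof of Lemma 14)] -/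
theorem lowestSeq_eq_none_of_card_lt (hcut : Q.CutProp) (hu : Q.D.card < u) : Q.lowestSeq ω u = none := by
  cases h : Q.lowestSeq ω u with
  | none => rfl
  | some p =>
    obtain ⟨c, z⟩ := p
    have h1 := pot_lowestSeq_ge hcut h
    have h2 : Q.pot c z ≤ Q.D.card := Finset.card_le_card Finset.sdiff_subset
    omega

/-- **Maximality of the exploration sequence**: every open crossing meets some term of the
sequence (Nolin 2008, proof of Lemma 15: any other crossing "has to cross at least one of the
`c_v` (by maximality of `𝒞`)"). Proof: an open crossing disjoint from all terms lies above each
of them (below is excluded by minimality), so it keeps the recursion alive forever,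
contradicting termination. [cite: Nolin2008, §4.4 (arXiv 0711.4948: proof of Lemma 14)] -/
theorem exists_lowestSeq_inter_nonempty (hcut : Q.CutProp) (ha : Q.IsCrossing a w)
    (haω : (↑a : Set (Site 2)) ⊆ ω) :
    ∃ u c z, Q.lowestSeq ω u = some (c, z) ∧ (a ∩ c).Nonempty := by
  by_contra hno
  push Not at hno
  have hno' : ∀ u c z, Q.lowestSeq ω u = some (c, z) → Disjoint a c := by
    intro u c z h
    rw [Finset.disjoint_iff_inter_eq_empty]
    exact hno u c z h
  -- by induction: every term exists and `a` lies above it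
  have key : ∀ u, ∃ c z, Q.lowestSeq ω u = some (c, z) ∧ a ⊆ Q.above c z := by
    intro u
    induction u with
    | zero =>
      cases h : Q.lowest ω with
      | none => exact absurd h (lowest_ne_none ha haω)
      | some p =>
        obtain ⟨c, z⟩ := p
        have hc := (isCrossing_of_lowest h).1
        refine ⟨c, z, h, ?_⟩
        rcases hc.subset_above_or_disjoint ha.subset ha.conn (hno' 0 c z h) with hh | hh
        · exact hh
        · exfalso
          refine not_subset_below_lowest h ha haω fun v hv => mem_below.2 ⟨ha.subset hv, ?_, ?_⟩
          · exact Finset.disjoint_left.1 (hno' 0 c z h) hv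
          · exact Finset.disjoint_left.1 hh hv
    | succ u ih =>
      obtain ⟨c, z, h, hab⟩ := ih
      have hc := (isCrossing_of_lowestSeq h).1
      -- `a` is open in `ω ∖ lower c`
      have haω' : (↑a : Set (Site 2)) ⊆ ω \ ↑(Q.lower c z) := by
        intro v hv
        refine ⟨haω hv, fun hvl => ?_⟩
        exact (mem_lower_iff_not_mem_above (ha.subset (Finset.mem_coe.1 hv))).1 (Finset.mem_coe.1 hvl)
          (hab (Finset.mem_coe.1 hv))
      rw [lowestSeq_succ_of_eq_some h]
      cases h' : Q.lowest (ω \ ↑(Q.lower c z)) with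
      | none => exact absurd h' (lowest_ne_none ha haω')
      | some p =>
        obtain ⟨c', z'⟩ := p
        have hseq : Q.lowestSeq ω (u + 1) = some (c', z') := by rw [lowestSeq_succ_of_eq_some h, h']
        have hc' := (isCrossing_of_lowest h').1
        refine ⟨c', z', rfl, ?_⟩
        rcases hc'.subset_above_or_disjoint ha.subset ha.conn (hno' (u + 1) c' z' hseq) with hh | hh
        · exact hh
        · exfalso
          refine not_subset_below_lowest h' ha haω' fun v hv => mem_below.2 ⟨ha.subset hv, ?_, ?_⟩
          · exact Finset.disjoint_left.1 (hno' (u + 1) c' z' hseq) hv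
          · exact Finset.disjoint_left.1 hh hv
  obtain ⟨c, z, h, -⟩ := key (Q.D.card + 1)
  rw [lowestSeq_eq_none_of_card_lt hcut (Nat.lt_succ_self _)] at h
  exact absurd h (by simp)

/-- **`{lowestSeq u = c}` is determined by the sites on or below `c`** (Nolin 2008, proof of
Lemma 15: "the event `{c_v = c̃_v, v ≤ u}` is independent from the status of the sites above
`c̃_u`"): if `ω'` agrees with `ω` on `lower c z`, then `lowestSeq ω u = (c, z)` iff
`lowestSeq ω' u = (c, z)`. [cite: Nolin2008, §4.4 (arXiv 0711.4948: proof of Lemma 14)] -/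
theorem lowestSeq_congr_aux (hcut : Q.CutProp) (hdual : Q.DualProp) :
    ∀ u (c : Finset (Site 2)) (z : Site 2) (ω ω' : Set (Site 2)),
      (∀ v ∈ Q.lower c z, v ∈ ω ↔ v ∈ ω') →
      Q.lowestSeq ω u = some (c, z) → Q.lowestSeq ω' u = some (c, z) := by
  intro u
  induction u with
  | zero =>
    intro c z ω ω' hagree h
    exact lowest_congr hcut hdual h hagree
  | succ u ih =>
    intro c z ω ω' hagree h
    obtain ⟨⟨c₀, z₀⟩, h₀⟩ := exists_lowestSeq_eq_some_of_succ h
    have hsub : Q.lower c₀ z₀ ⊆ Q.lower c z := (lowestSeq_succ_subset_above hcut h₀ h).2.2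
    have h₀' : Q.lowestSeq ω' u = some (c₀, z₀) := ih c₀ z₀ ω ω' (fun v hv => hagree v (hsub hv)) h₀
    rw [lowestSeq_succ_of_eq_some h₀] at h
    rw [lowestSeq_succ_of_eq_some h₀']
    refine lowest_congr hcut hdual h fun v hv => ?_
    simp only [Set.mem_sdiff, Finset.mem_coe]
    rw [hagree v hv]

/-- `{lowestSeq u = (c, z)}` is determined by the sites of `lower c z` (symmetric form). [cite: KestenPTM1982, §2.3 Prop. 2.3] -/
theorem lowestSeq_congr (hcut : Q.CutProp) (hdual : Q.DualProp)
    (hagree : ∀ v ∈ Q.lower c z, v ∈ ω ↔ v ∈ ω') :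
    Q.lowestSeq ω u = some (c, z) ↔ Q.lowestSeq ω' u = some (c, z) :=
  ⟨lowestSeq_congr_aux hcut hdual u c z ω ω' hagree,
    lowestSeq_congr_aux hcut hdual u c z ω' ω fun v hv => (hagree v hv).symm⟩

/-- **The first `T` terms are `T` pairwise disjoint open crossings**: if the `u`-th term exists,
there is a family of `u + 1` pairwise disjoint open crossings (the input of the BK inequality in
Nolin's bound `P(t ≥ T) ≤ (1 - δ')^T`). [cite: Nolin2008, §4.4 (arXiv 0711.4948: proof of Lemma 14)] -/
theorem exists_disjoint_family_of_lowestSeq (hcut : Q.CutProp) (h : Q.lowestSeq ω u ≠ none) :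
    ∃ f : Fin (u + 1) → Finset (Site 2) × Site 2,
      (∀ i, Q.IsCrossing (f i).1 (f i).2 ∧ (↑(f i).1 : Set (Site 2)) ⊆ ω) ∧
      Pairwise fun i j => Disjoint (f i).1 (f j).1 := by
  have hall : ∀ i : Fin (u + 1), ∃ p, Q.lowestSeq ω i = some p := by
    intro i
    cases hi : Q.lowestSeq ω i with
    | none => exact absurd (lowestSeq_eq_none_of_le hi (Nat.lt_succ_iff.1 i.2)) h
    | some p => exact ⟨p, rfl⟩
  choose f hf using hall
  refine ⟨f, fun i => isCrossing_of_lowestSeq (c := (f i).1) (z := (f i).2) (hf i), ?_⟩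
  intro i j hij
  rcases lt_or_gt_of_ne (Fin.val_ne_of_ne hij) with hlt | hlt
  · exact lowestSeq_disjoint_of_lt hcut hlt (c := (f i).1) (z := (f i).2) (c' := (f j).1) (z' := (f j).2)
      (hf i) (hf j)
  · exact (lowestSeq_disjoint_of_lt hcut hlt (c := (f j).1) (z := (f j).2) (c' := (f i).1) (z' := (f i).2)
      (hf j) (hf i)).symm

/-- **Locality of the exploration** in the tree's `DeterminedBy` form: the event
`{ω | lowestSeq ω u = (c, z)}` is determined by the sites of `lower c z = c ∪ below c z`
(Kesten 1982, Prop. 2.3; Nolin 2008, proof of Lemma 15). [cite: KestenPTM1982, §2.3 Prop. 2.3] -/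
theorem determinedBy_lowestSeq_eq (hcut : Q.CutProp) (hdual : Q.DualProp) (u : ℕ)
    (c : Finset (Site 2)) (z : Site 2) :
    DeterminedBy {ω : Set (Site 2) | Q.lowestSeq ω u = some (c, z)} (↑(Q.lower c z) : Set (Site 2)) := by
  rw [determinedBy_iff]
  intro ω ω' hF
  simp only [Set.mem_setOf_eq]
  refine lowestSeq_congr hcut hdual fun v hv => ?_
  have := Set.ext_iff.1 hF v
  simp only [Set.mem_inter_iff, Finset.mem_coe] at this
  exact ⟨fun h => (this.1 ⟨h, hv⟩).1, fun h => (this.2 ⟨h, hv⟩).1⟩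

/-- The events `{lowestSeq u = p}` for distinct `p` are disjoint. [cite: KestenPTM1982, §2.3 Prop. 2.3] -/
theorem disjoint_setOf_lowestSeq_eq {p p' : Finset (Site 2) × Site 2} (hpp' : p ≠ p') :
    Disjoint {ω : Set (Site 2) | Q.lowestSeq ω u = some p} {ω | Q.lowestSeq ω u = some p'} :=
  Set.disjoint_left.2 fun _ h h' => hpp' (Option.some_injective _ ((Eq.symm h).trans h'))

end Sequence

end JDomain

end Literature.Probability.Percolation
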